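import Summits.CriticalPhenomena.PercolationContinuityZ3.Theorems.Transplant.TwoAxisParaCells
import HarnessLib

/-!
# N1 (the `{±1}` node), LEVEL 1: the FIXED-STRIDE STEERED RUN — the N1 twin of D″'s band run `ChainPlanar.Band` (`KNCells2ChainBand`) in exact
# integer RUN COORDINATES `(a, b)` (along, transverse): thick cores whose slack grows by the per-step siting radius, one stride interval per run,
# a drifting steering window, and the route property "link box ⊆ region, steered landing piece ⊆ next core" — pure `ℤ` arithmetic

builds on p205010 (kernel theorem, internal audit signed; external expert review pending) — nothing in this file uses p205010; nothing here is a
claim about the open node `SamePDropOfSkeletonNeg`.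
Lane `prim-bschramm`, seat `prim-bschramm-p1` (gen 11; NEG-SCOPE v1.1 §5 'LEVEL 1 chain records' row / P5-R2: "the LEVEL-1 RUN records are re-typed
(fixed extent, thick cores, y′ top-layer slack; p1 lineage)"; spec memo `HOME/prim-bschramm-p1/N1-RUN-RECORDS.md`); helper file
(`--supports stmt-CriticalPhenomena-4575 --as helper`).

WHY A NEW RECORD (hp-8 NEG-NODE-F-SCOPE §11).  D″'s `route_band_advance` CHOOSES the extent `ℓ(v) = L + s − level(v)` per walker so that the band
rectangle's side lands ON the next core line.  Under N1 each stride family has ONE extent (Martineau–Tassion's equilibrium data `(n, h, ℓ, v)` has no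
continuity in `n`), so the landing inherits the walker's slack: cores are THICK and their along-thickness grows by the siting slack `ea` per step
(`± (q + k·ea)` after `k` strides) — the along-axis twin of D″'s transverse growth `coreW k = w₁ + (k−1)R′`.

THE RECORD.  Parameters `P : RunPrm`: the along stride interval `[sLo, sHi]`, the transverse drift `d` per stride, the landing pieces `[0, Pp]`
(`τ = 1`) / `[−Pm, 0]` (`τ = −1`) relative to the drifted position, the steering window `[−Wm, Wp]`, the per-step siting slack `(ea, eb)` (seed centre vs
contact), the link half-sizes `(La, Lb)` (the box holding one stride's link region about the seed centre), the start half-width `q`, the length `N`.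
Admissibility `RunOK`: `0 ≤ sLo ≤ sHi ≤ La`, `|d| ≤ Lb`, `Pm ≤ Wm`, `Pp ≤ Wp`.  In run coordinates relative to the run origin:
`core k = [k·sLo − q − k·ea, k·sHi + q + k·ea] × (k·d + [−(Wm + k·eb), Wp + k·eb])` (contact positions after `k` strides), `enl k` = `core k` widened by
`(ea, eb)` (seed centres), `region k` = `enl k` widened by `(La, Lb)`, `prism` = the hull of the regions `k ≤ N`; the steering sign `steer k b = −1` iff
`0 ≤ b − k·d` (take the piece pointing back to the window centre).
THE TWO MARTINEAU–TASSION FAMILIES (§5; sheared skeleton frame `(α, β′)`, `β′ = n·β − h·α`, run sign absorbed into the coordinates):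
x-run (u-strides, pieces = side halves `{α = α_t + n, β′ − β′_t ∈ τ[0, nℓ]}`): `sLo = sHi = n`, `d = 0`, `Pp = Pm = Wp = Wm = nℓ`, `ea = R′`, `eb = (n+|h|)R′`,
`La = n`, `Lb = 3nℓ`; y′-run (v-strides, pieces = top pieces `{β′ − β′_t ∈ (nℓ − n − |h|, nℓ], α − α_t ∈ [v, n] or [−n, v]}`): `sLo = nℓ − (n+|h|) + 1`,
`sHi = nℓ`, `d = v`, `Pp = Wp = n − v`, `Pm = Wm = n + v`, `ea = (n+|h|)R′`, `eb = R′`, `La = 3nℓ`, `Lb = n` — hp-8's `steer_sym` / `steer_pieces` are exactly the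
two window invariants.
* §1 `RunPrm`, `RunOK`; §2 `aLo/aHi/bLo/bHi`, `InCore`, `InEnl`, `InRegion`, `InPrism`, `steer`, `InPiece` (+ unfolding lemmas);
* §3 `inEnl_of_inCore`, `inRegion_of_inEnl`, **`inRegion_of_link`**, **`inCore_succ_of_landing`** (the steered landing lies in the next core), **`route`**,
  `inRegion_of_inCore_succ`, `inPrism_of_inRegion`, `inCore_nonempty`, `inCore_zero_iff`;
* §4 monotonicity in `k` of the slacks (`aLo_sub_le`-type facts used by the schedule file); §5 **`xPrm`**, **`yPrm`**, `xPrm_ok`, `yPrm_ok`.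
[cite: MartineauTassion2017, §4.1 (the cell lattice z₁u + z₂v + P), §4.3 Lemma 4.2 (piece choice by position; arXiv:1312.1946 pp. 12–14)]
[cite: KozmaNitzan2024, §4 Lemma 11 (pp. 22–23: the straight run, ℓ(v), F(v))]
-/

namespace Summit.CriticalPhenomena.PercolationContinuityZ3.Theorems.Transplant

namespace ChainPara

/-! ## §1 Parameters and admissibility -/

/-- **Parameters of a fixed-stride steered run** (see the module docstring for the meaning of each field). [this work] -/
structure RunPrm where
  /-- minimal along-progress of one stride -/
  sLo : ℤ
  /-- maximal along-progress of one stride -/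
  sHi : ℤ
  /-- nominal transverse drift of one stride -/
  d : ℤ
  /-- the `τ = 1` landing piece is `[0, Pp]` (transverse, relative to the drifted position) -/
  Pp : ℕ
  /-- the `τ = −1` landing piece is `[−Pm, 0]` -/
  Pm : ℕ
  /-- upper half-width of the steering window -/
  Wp : ℕ
  /-- lower half-width of the steering window -/
  Wm : ℕ
  /-- along siting slack per step (seed centre vs contact) -/
  ea : ℕ
  /-- transverse siting slack per step -/
  eb : ℕ
  /-- along half-size of the link box of one stride about the seed centre -/
  La : ℕ
  /-- transverse half-size of the link box -/
  Lb : ℕ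
  /-- half-width of the start box (core `0` along; the start contacts) -/
  q : ℕ
  /-- the run has steps `0, …, N` -/
  N : ℕ

/-- **Admissible run parameters**: nonnegative stride progress, the stride fits in the link box along, the drift fits in the link box transversally,
and each landing piece fits in the steering window on its side. [this work] -/
structure RunOK (P : RunPrm) : Prop where
  /-- strides do not go backwards -/
  hs0 : 0 ≤ P.sLo
  /-- the stride interval is an interval -/
  hs : P.sLo ≤ P.sHi
  /-- one stride's landing lies in its link box (along) -/
  hsL : P.sHi ≤ P.La
  /-- the drift lies in the link box (transverse) -/
  hd : |P.d| ≤ P.Lb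
  /-- the lower piece fits in the lower window -/
  hPm : P.Pm ≤ P.Wm
  /-- the upper piece fits in the upper window -/
  hPp : P.Pp ≤ P.Wp

namespace RunPrm

variable (P : RunPrm)

/-! ## §2 Cores, enlarged cores, regions, the prism, steering, pieces -/

/-- Lower along-bound of core `k`: `k·sLo − q − k·ea`. [this work] -/
def aLo (k : ℕ) : ℤ := (k : ℤ) * P.sLo - P.q - (k : ℤ) * P.ea

/-- Upper along-bound of core `k`: `k·sHi + q + k·ea`. [this work] -/
def aHi (k : ℕ) : ℤ := (k : ℤ) * P.sHi + P.q + (k : ℤ) * P.ea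

/-- Lower transverse bound of core `k`: `k·d − (Wm + k·eb)`. [this work] -/
def bLo (k : ℕ) : ℤ := (k : ℤ) * P.d - (P.Wm + (k : ℤ) * P.eb)

/-- Upper transverse bound of core `k`: `k·d + (Wp + k·eb)`. [this work] -/
def bHi (k : ℕ) : ℤ := (k : ℤ) * P.d + (P.Wp + (k : ℤ) * P.eb)

/-- **Core `k`** (positions of the contacts after `k` strides, in run coordinates). [cite: KozmaNitzan2024, §4 Lemma 11 (p. 22: the target boxes)] -/
def InCore (k : ℕ) (a b : ℤ) : Prop := P.aLo k ≤ a ∧ a ≤ P.aHi k ∧ P.bLo k ≤ b ∧ b ≤ P.bHi k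

/-- **Enlarged core `k`** (positions of the seed centres sited within `(ea, eb)` of a contact of core `k`). [this work] -/
def InEnl (k : ℕ) (a b : ℤ) : Prop :=
  P.aLo k - P.ea ≤ a ∧ a ≤ P.aHi k + P.ea ∧ P.bLo k - P.eb ≤ b ∧ b ≤ P.bHi k + P.eb

/-- **Region `k`** (holds the link box of every stride started from the enlarged core `k`). [cite: KozmaNitzan2024, §4 Lemma 11 (p. 22: the slabs of Ω)] -/
def InRegion (k : ℕ) (a b : ℤ) : Prop :=
  P.aLo k - P.ea - P.La ≤ a ∧ a ≤ P.aHi k + P.ea + P.La ∧ P.bLo k - P.eb - P.Lb ≤ b ∧ b ≤ P.bHi k + P.eb + P.Lb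

/-- **The prism** (one box holding every region `k ≤ N`; along `[−q − (N+1)ea − La, N·sHi + q + (N+1)ea + La]`, transversally the drift is bounded by `N·|d|`). [cite: KozmaNitzan2024, §4 Lemma 11 (p. 22: Ω)] -/
def InPrism (a b : ℤ) : Prop :=
  -(P.q : ℤ) - ((P.N : ℤ) + 1) * P.ea - P.La ≤ a ∧ a ≤ (P.N : ℤ) * P.sHi + P.q + ((P.N : ℤ) + 1) * P.ea + P.La ∧
    -((P.N : ℤ) * |P.d|) - (P.Wm + ((P.N : ℤ) + 1) * P.eb) - P.Lb ≤ b ∧ b ≤ (P.N : ℤ) * |P.d| + (P.Wp + ((P.N : ℤ) + 1) * P.eb) + P.Lb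

/-- **The steering sign at step `k`** from transverse position `b`: `−1` (the lower piece) iff `b` lies at or above the drifted window centre `k·d`.
[cite: MartineauTassion2017, §4.3 Lemma 4.2] -/
def steer (k : ℕ) (b : ℤ) : ℤ := if 0 ≤ b - (k : ℤ) * P.d then -1 else 1

/-- **The landing piece of sign `τ`** as a transverse offset `δ` relative to the drifted position: `[0, Pp]` for `τ = 1`, `[−Pm, 0]` for `τ = −1`.
[cite: MartineauTassion2017, §3.2 (the pieces L(a,u), L(u,b), L(v,b), L(−a,v))] -/
def InPiece (τ δ : ℤ) : Prop := (τ = 1 → 0 ≤ δ ∧ δ ≤ P.Pp) ∧ (τ = -1 → -(P.Pm : ℤ) ≤ δ ∧ δ ≤ 0)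

/-- The steering sign is `±1`. [folklore] -/
theorem steer_eq_or (k : ℕ) (b : ℤ) : P.steer k b = 1 ∨ P.steer k b = -1 := by
  unfold steer; split_ifs <;> simp

/-- The steering sign is `−1` exactly above the window centre. [folklore] -/
theorem steer_eq_neg_one_iff (k : ℕ) (b : ℤ) : P.steer k b = -1 ↔ 0 ≤ b - (k : ℤ) * P.d := by
  unfold steer
  split_ifs with h
  · exact ⟨fun _ => h, fun _ => rfl⟩
  · exact ⟨fun h' => absurd h' (by norm_num), fun h' => absurd h' h⟩

/-- The steering sign is `1` exactly below the window centre. [folklore] -/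
theorem steer_eq_one_iff (k : ℕ) (b : ℤ) : P.steer k b = 1 ↔ b - (k : ℤ) * P.d < 0 := by
  unfold steer
  split_ifs with h
  · exact ⟨fun h' => absurd h' (by norm_num), fun h' => absurd h (not_le.2 h')⟩
  · exact ⟨fun _ => not_le.1 h, fun _ => rfl⟩

/-! ## §3 The route property and the containments -/

variable {P}

/-- A contact position is a seed-centre position (the core lies in its enlargement). [folklore] -/
theorem inEnl_of_inCore {k : ℕ} {a b : ℤ} (h : P.InCore k a b) : P.InEnl k a b := by
  obtain ⟨h1, h2, h3, h4⟩ := h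
  have hea : (0 : ℤ) ≤ P.ea := by positivity
  have heb : (0 : ℤ) ≤ P.eb := by positivity
  exact ⟨by linarith, by linarith, by linarith, by linarith⟩

/-- The enlarged core lies in the region. [folklore] -/
theorem inRegion_of_inEnl {k : ℕ} {a b : ℤ} (h : P.InEnl k a b) : P.InRegion k a b := by
  obtain ⟨h1, h2, h3, h4⟩ := h
  have hLa : (0 : ℤ) ≤ P.La := by positivity
  have hLb : (0 : ℤ) ≤ P.Lb := by positivity
  exact ⟨by linarith, by linarith, by linarith, by linarith⟩

/-- **The link box of a stride from an enlarged-core point lies in the region.** [cite: KozmaNitzan2024, §4 Lemma 11 (p. 22)] -/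
theorem inRegion_of_link {k : ℕ} {a b : ℤ} (hv : P.InEnl k a b) {a' b' : ℤ} (ha : |a' - a| ≤ P.La) (hb : |b' - b| ≤ P.Lb) :
    P.InRegion k a' b' := by
  obtain ⟨h1, h2, h3, h4⟩ := hv
  rw [abs_le] at ha hb
  exact ⟨by linarith [ha.1], by linarith [ha.2], by linarith [hb.1], by linarith [hb.2]⟩

/-- **The steered landing lies in the next core**: from a seed centre `(a, b)` in the enlarged core `k`, every landing point — along-progress in
`[sLo, sHi]`, transverse offset (relative to the drift `d`) in the piece of sign `steer k b` — lies in core `k + 1`.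
[cite: MartineauTassion2017, §4.3 Lemma 4.2] [cite: KozmaNitzan2024, §4 Lemma 11 (pp. 22–23)] -/
theorem inCore_succ_of_landing (hP : RunOK P) {k : ℕ} {a b : ℤ} (hv : P.InEnl k a b) {a' b' : ℤ}
    (ha1 : P.sLo ≤ a' - a) (ha2 : a' - a ≤ P.sHi) (hb : P.InPiece (P.steer k b) (b' - b - P.d)) : P.InCore (k + 1) a' b' := by
  obtain ⟨h1, h2, h3, h4⟩ := hv
  have hPm := hP.hPm; have hPp := hP.hPp
  simp only [InCore, aLo, aHi, bLo, bHi] at h1 h2 h3 h4 ⊢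
  push_cast
  refine ⟨by linarith, by linarith, ?_, ?_⟩
  · -- lower transverse bound
    rcases P.steer_eq_or k b with hτ | hτ
    · have hlt := (P.steer_eq_one_iff k b).1 hτ
      have hδ := hb.1 hτ
      nlinarith [hδ.1]
    · have hge := (P.steer_eq_neg_one_iff k b).1 hτ
      have hδ := hb.2 hτ
      have : (P.Pm : ℤ) ≤ P.Wm := by exact_mod_cast hPm
      nlinarith [hδ.1]
  · -- upper transverse bound
    rcases P.steer_eq_or k b with hτ | hτ
    · have hlt := (P.steer_eq_one_iff k b).1 hτ
      have hδ := hb.1 hτ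
      have : (P.Pp : ℤ) ≤ P.Wp := by exact_mod_cast hPp
      nlinarith [hδ.2]
    · have hge := (P.steer_eq_neg_one_iff k b).1 hτ
      have hδ := hb.2 hτ
      nlinarith [hδ.2]

/-- **THE ROUTE PROPERTY of the fixed-stride run** (the N1 twin of `ChainPlanar.Band.core_route`): from every seed centre of the enlarged core `k`,
the link box lies in region `k` and the landing through the steered piece lies in core `k + 1`. [cite: KozmaNitzan2024, §4 Lemma 11 (pp. 22–23)]
[cite: MartineauTassion2017, §4.3 Lemma 4.2] -/
theorem route (hP : RunOK P) {k : ℕ} {a b : ℤ} (hv : P.InEnl k a b) :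
    (∀ a' b' : ℤ, |a' - a| ≤ P.La → |b' - b| ≤ P.Lb → P.InRegion k a' b') ∧
      ∀ a' b' : ℤ, P.sLo ≤ a' - a → a' - a ≤ P.sHi → P.InPiece (P.steer k b) (b' - b - P.d) → P.InCore (k + 1) a' b' :=
  ⟨fun _ _ ha hb => inRegion_of_link hv ha hb, fun _ _ ha1 ha2 hb => inCore_succ_of_landing hP hv ha1 ha2 hb⟩

/-- **The next core lies in the region** (`sHi ≤ La`, `|d| ≤ Lb`, `0 ≤ sLo`). [cite: KozmaNitzan2024, §4 Lemma 11 (p. 22)] -/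
theorem inRegion_of_inCore_succ (hP : RunOK P) {k : ℕ} {a b : ℤ} (h : P.InCore (k + 1) a b) : P.InRegion k a b := by
  obtain ⟨h1, h2, h3, h4⟩ := h
  have hs0 := hP.hs0; have hsL := hP.hsL; have hd := hP.hd
  rw [abs_le] at hd
  have hea : (0 : ℤ) ≤ P.ea := by positivity
  have heb : (0 : ℤ) ≤ P.eb := by positivity
  have hk : (0 : ℤ) ≤ k := by positivity
  simp only [InRegion, aLo, aHi, bLo, bHi] at h1 h2 h3 h4 ⊢
  push_cast at h1 h2 h3 h4
  refine ⟨by nlinarith, by nlinarith, by nlinarith, by nlinarith⟩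

/-- **Every region `k ≤ N` lies in the prism.** [cite: KozmaNitzan2024, §4 Lemma 11 (p. 22: Ω)] -/
theorem inPrism_of_inRegion (hP : RunOK P) {k : ℕ} (hk : k ≤ P.N) {a b : ℤ} (h : P.InRegion k a b) : P.InPrism a b := by
  obtain ⟨h1, h2, h3, h4⟩ := h
  have hs0 := hP.hs0; have hs := hP.hs
  have hea : (0 : ℤ) ≤ P.ea := by positivity
  have heb : (0 : ℤ) ≤ P.eb := by positivity
  have hk0 : (0 : ℤ) ≤ k := by positivity
  have hkN : (k : ℤ) ≤ P.N := by exact_mod_cast hk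
  have hdk : |(k : ℤ) * P.d| ≤ (P.N : ℤ) * |P.d| := by
    rw [abs_mul, abs_of_nonneg hk0]; exact mul_le_mul_of_nonneg_right hkN (abs_nonneg _)
  rw [abs_le] at hdk
  simp only [InPrism, aLo, aHi, bLo, bHi] at h1 h2 h3 h4 ⊢
  refine ⟨by nlinarith, by nlinarith, by nlinarith [hdk.1], by nlinarith [hdk.2]⟩

/-- **Every core is nonempty** (it contains the nominal position `(k·sLo, k·d)`). [folklore] -/
theorem inCore_nominal (hP : RunOK P) (k : ℕ) : P.InCore k ((k : ℤ) * P.sLo) ((k : ℤ) * P.d) := by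
  have hs := hP.hs
  have hea : (0 : ℤ) ≤ P.ea := by positivity
  have heb : (0 : ℤ) ≤ P.eb := by positivity
  have hq : (0 : ℤ) ≤ P.q := by positivity
  have hWp : (0 : ℤ) ≤ P.Wp := by positivity
  have hWm : (0 : ℤ) ≤ P.Wm := by positivity
  have hk0 : (0 : ℤ) ≤ k := by positivity
  simp only [InCore, aLo, aHi, bLo, bHi]
  refine ⟨by nlinarith, by nlinarith, by nlinarith, by nlinarith⟩

/-- Core `0` is the start box `[−q, q] × [−Wm, Wp]`. [folklore] -/
theorem inCore_zero_iff (a b : ℤ) : P.InCore 0 a b ↔ -(P.q : ℤ) ≤ a ∧ a ≤ P.q ∧ -(P.Wm : ℤ) ≤ b ∧ b ≤ P.Wp := by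
  unfold InCore aLo aHi bLo bHi; simp

end RunPrm

/-! ## §4 The two Martineau–Tassion stride families -/

/-- **x-run parameters** (u-strides read in `(a, b) = (σα, σβ′)`: along-progress exactly `n`; landing pieces = the side halves `β′ − β′_t ∈ ±[0, nℓ]`;
no drift; window `±nℓ`; siting slack `R′` along and `(n + |h|)·R′` in `β′`; link box `n × 3nℓ` = the parallelogram `C(n, h, 3ℓ)` exactly).
[cite: MartineauTassion2017, §3.2 Lemma 3.5 (the pieces L(a,u), L(u,b)), §4.3 Lemma 4.2] -/
def xPrm (n ℓ : ℕ) (h : ℤ) (R' q N : ℕ) : RunPrm where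
  sLo := n
  sHi := n
  d := 0
  Pp := n * ℓ
  Pm := n * ℓ
  Wp := n * ℓ
  Wm := n * ℓ
  ea := R'
  eb := (n + h.natAbs) * R'
  La := n
  Lb := 3 * (n * ℓ)
  q := q
  N := N

/-- **y′-run parameters** (v-strides read in `(a, b) = (σβ′, σα)`: along-progress in `[nℓ − (n + |h|) + 1, nℓ]` (the top layer); drift `v` per stride;
landing pieces `[0, n − v]` / `[−(n + v), 0]` (the top pieces split at `α = v`); window `[−(n + v), n − v]`; siting slack `(n + |h|)·R′` in `β′` and `R′` in `α`;
link box `3nℓ × n`). [cite: MartineauTassion2017, §3.2 Lemma 3.5 (the pieces L(v,b), L(−a,v)), §4.3 Lemma 4.2] -/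
def yPrm (n ℓ : ℕ) (h v : ℤ) (R' q N : ℕ) : RunPrm where
  sLo := (n : ℤ) * ℓ - (n + h.natAbs : ℕ) + 1
  sHi := (n : ℤ) * ℓ
  d := v
  Pp := (n - v).toNat
  Pm := (n + v).toNat
  Wp := (n - v).toNat
  Wm := (n + v).toNat
  ea := (n + h.natAbs) * R'
  eb := R'
  La := 3 * (n * ℓ)
  Lb := n
  q := q
  N := N

/-- **The x-run parameters are admissible.** [folklore] -/
theorem xPrm_ok (n ℓ : ℕ) (h : ℤ) (R' q N : ℕ) : RunOK (xPrm n ℓ h R' q N) where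
  hs0 := by simp [xPrm]
  hs := le_rfl
  hsL := by simp [xPrm]
  hd := by simp only [xPrm, abs_zero]; positivity
  hPm := le_rfl
  hPp := le_rfl

/-- **The y′-run parameters are admissible** for a split point `|v| ≤ n` of the top layer, under the layer inequality `n + |h| ≤ n·ℓ + 1` (implied by the
zone-clearance inequality `(M+1)(n+|h|) ≤ n(ℓ+1)` of `EquilibriumAt` as soon as `M ≥ 1`). [folklore] -/
theorem yPrm_ok {n ℓ : ℕ} {h v : ℤ} (hn : 1 ≤ n) (hv : |v| ≤ n) (hlay : (n + h.natAbs : ℕ) ≤ (n : ℤ) * ℓ + 1) (R' q N : ℕ) :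
    RunOK (yPrm n ℓ h v R' q N) where
  hs0 := by simp only [yPrm]; omega
  hs := by have h0 := abs_nonneg h; simp only [yPrm]; push_cast; omega
  hsL := by simp only [yPrm]; push_cast; nlinarith
  hd := by simp only [yPrm]; exact_mod_cast hv
  hPm := le_rfl
  hPp := le_rfl

/-- The y′-window unfolded: `Wp = n − v`, `Wm = n + v` as integers (`|v| ≤ n`). [folklore] -/
theorem yPrm_window {n : ℕ} {v : ℤ} (hv : |v| ≤ n) (ℓ : ℕ) (h : ℤ) (R' q N : ℕ) :
    ((yPrm n ℓ h v R' q N).Wp : ℤ) = n - v ∧ ((yPrm n ℓ h v R' q N).Wm : ℤ) = n + v ∧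
      ((yPrm n ℓ h v R' q N).Pp : ℤ) = n - v ∧ ((yPrm n ℓ h v R' q N).Pm : ℤ) = n + v := by
  rw [abs_le] at hv
  simp only [yPrm]
  refine ⟨?_, ?_, ?_, ?_⟩ <;> omega

/-- **The zone-clearance inequality gives the layer inequality**: `(M+1)(n+|h|) ≤ n(ℓ+1)` with `1 ≤ M` implies `n + |h| ≤ nℓ + 1` (indeed `≤ nℓ`
unless `n + |h| = 0`). [folklore] -/
theorem layer_of_clearance {n ℓ M : ℕ} {h : ℤ} (hM : 1 ≤ M) (hc : (M + 1 : ℤ) * (n + h.natAbs : ℕ) ≤ (n : ℤ) * (ℓ + 1 : ℕ)) :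
    (n + h.natAbs : ℕ) ≤ (n : ℤ) * ℓ + 1 := by
  push_cast at hc ⊢
  have hM' : (1 : ℤ) ≤ M := by exact_mod_cast hM
  have h0 : (0 : ℤ) ≤ n + |h| := by positivity
  have h2 : 2 * ((n : ℤ) + |h|) ≤ n * (ℓ + 1) := le_trans (by nlinarith [mul_nonneg (sub_nonneg.2 hM') h0]) hc
  nlinarith [abs_nonneg h]

end ChainPara

end Summit.CriticalPhenomena.PercolationContinuityZ3.Theorems.Transplant
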